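import Literature.AnabelianGeometry.AbsoluteAnabelian.MonoidKummerGaloisCyclotomeCanonical
import Literature.AnabelianGeometry.AbsoluteAnabelian.GaloisCyclotomeRestriction
import Literature.AnabelianGeometry.AbsoluteAnabelian.MLFGaloisLogFrobeniusFactorizationIso
import HarnessLib

/-!
# [AbsTopIII] Prop 3.2 (ii) / Rmk 3.2.1 with `μ_Ẑ(G)`-coefficients along GENERAL MORPHISMS of MLF-Galois
# `TM`-pairs: the covered open injection `β`, the group-theoretic `μ_Ẑ(β)`, naturality modulo the
# coefficient square — and its FAILURE along the power endomorphisms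

S. Mochizuki, *Topics in Absolute Anabelian Geometry III*, §3 (bib key `MochizukiAbsTopIII2015`; kurims
manuscript pages, lit key `paper:url-5493eb38cbb7`): Def. 3.1 (ii) p. 67 (a morphism
`φ = (φ_Π, φ_M) : (Π₁ ↷ M₁) → (Π₂ ↷ M₂)` of MLF-Galois `TM`-pairs: `φ_M` ANY compatible morphism of monoids,
`φ_Π` continuous «that induces an open injective homomorphism between the respective arithmetic Galois
groups»), Prop. 3.2 preamble p. 71 l. 15–17 («functorial algorithms … relative to `𝒞^MLF_T`»), Prop. 3.2 (ii)
p. 71 l. 61 – p. 72 l. 6 («the «`μ_Ẑ(M_TM)`» may be replaced by «`μ_Ẑ(G)`» [cf. Remark 3.2.1 below]»),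
Cor. 1.10 (i) p. 42 («the underlying module of … `μ_Ẑ(G_k)` is unaffected by … passing … to an open
subgroup»; functoriality «with respect to arbitrary injective open homomorphisms»), Rmk. 3.2.2 p. 73.
THE POINT (abc-iut cell, layer L4, row «P32ii-MUZHAT-HOM-NAT», L4-lead RULING #8h (2): «(ii)'s analogue of
L07; without it (ii) is iso-functorial only»; sequel of `MonoidKummerGaloisCyclotomeCanonical.lean`).  For a
MORPHISM `φ` of MODEL MLF-Galois `TM`-pairs `(Π₁ ↷ 𝒪_k̄₁^⊳) → (Π₂ ↷ 𝒪_k̄₂^⊳)` (abc-iut-L4-t2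
`GaloisMonoidPair.Hom`, open-injectivity typed by `comap_ker` / `isOpen_image`):
* `GaloisMonoidPair.Hom.galoisHom φ` — the INJECTIVE homomorphism `β : Gal(k̄₁/k₁) → Gal(k̄₂/k₂)` covered by
  `φ_Π` (`galoisHom_aug`, `eq_galoisHom_of_aug`, `galoisHom_injective`); for OPEN augmentations (print's «the
  quotient `Π_k ↠ G_k`», Def. 3.1 (i) — every étale or tempered fundamental group) `β` is CONTINUOUS with OPEN
  IMAGE (`continuous_galoisHom`, `isOpen_range_galoisHom`): print's «open injective homomorphism»;
  `absGaloisHom` — the same into Mathlib's absolute Galois groups;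
* `GaloisMonoidPair.Hom.muZhatMap φ : μ_Ẑ(G_{k₁}) ⥲ μ_Ẑ(G_{k₂})` — the GROUP-THEORETIC `μ_Ẑ(β)` of Cor. 1.10 (i)
  along the open injection `β` (abc-iut-w5-d201 / abc-iut-L4-t17 `muZhat.mapOfOpenEmbedding`), `β`-equivariant
  (`muZhatMap_smul`); the coefficient morphism `muZhatCoeffHom` and the two legs `pullMuZhat = φ_Π^*`,
  `pushMuZhat = μ_Ẑ(β)_*` of the cospan `H¹(H₂, μ_Ẑ(G_{k₂})) → H¹(H₁, res_{φ_Π} μ_Ẑ(G_{k₂})) ← H¹(H₁, μ_Ẑ(G_{k₁}))`;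
* **`pullMuZhat_kummerMuZhat_eq_pushMuZhat_of_square`** — NATURALITY `φ_Π^* κ^G_{H₂}(φ_M m) = μ_Ẑ(β)_* κ^G_{H₁}(m)`
  GIVEN the coefficient square `Λ(rootsHom₂) ∘ μ_Ẑ(β) = Λ(φ_M^gp) ∘ Λ(rootsHom₁)` (`hsq`), from abc-iut-L4-t2's
  `Λ(k̄ˣ)`-valued `ModelMLFGaloisData.kummer_natural` (p429531).  For ISOMORPHISMS the square holds for THE
  data (`MLFGaloisTMIsoUnitsTransport`); for the field-theoretic restriction morphisms it is the compatibility
  of THE data under restriction «by the Verlagerung» ([AbsAnab] Prop. 1.2.1 (vii) p. 11; abc-iut-L4-t11's lane,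
  to be consumed by a sequel);
* **`kummerMuZhat_powEnd_ne`** — the square is NOT available on all of `𝒞^MLF_TM`: along the power
  endomorphism `(𝟙_Π, x ↦ x²)` (abc-iut-L4-t9's `GaloisMonoidPair.powEnd`, a morphism of Def. 3.1 (ii) with
  `β = 𝟙`; finding E-L4-10) `κ^G_H(φ_M m) = 2 κ^G_H(m) ≠ κ^G_H(m)` for `m = 2 ∈ 𝒪_k̄^⊳` — «`μ_Ẑ(M_TM)` may be
  replaced by `μ_Ẑ(G)`» is functorial on isomorphisms / `T`-isomorphisms (`𝒞̲`), not on `𝒞^MLF_TM`.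

Small DATA definitions (`galoisHom`, `galoisContinuousHom`, `absGaloisHom`, `muZhatMap`, `muZhatCoeffHom`,
the two legs); no `Prop`-valued definition, no instance.  Universe `0`.  HONEST FRAMING: classical Kummer
theory / local class field theory as proved in the tree; nothing here bears on [IUTchIII] Cor. 3.12; no side
is taken; nothing asserts that abc is proved or refuted.
-/

noncomputable section

open scoped nonZeroDivisors

namespace Literature.AnabelianGeometry.AbsoluteAnabelian

open _root_.CategoryTheory groupCohomology _root_.ValuativeRel Field
open Literature.AnabelianGeometry.EtaleTheta (EquivariantMorphism)
open Literature.NumberTheory.GaloisRepresentations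

namespace GaloisMonoidPair.Hom

variable {C₁ C₂ : MLFClosure.{0}} {D₁ : ModelMLFGaloisData C₁.k C₁.K} {D₂ : ModelMLFGaloisData C₂.k C₂.K}
  (φ : GaloisMonoidPair.Hom D₁.tmPair D₂.tmPair)

/-! ### §1 The open injection `β : Gal(k̄₁/k₁) ↪ Gal(k̄₂/k₂)` covered by `φ_Π` -/

/-- `Ker(ε₂ ∘ φ_Π) = Ker ε₁` (`φ_Π⁻¹` of the arithmetic kernel is the arithmetic kernel, Def. 3.1 (ii)).
[cite: MochizukiAbsTopIII2015, Definition 3.1 (ii) p.67] -/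
theorem ker_aug_comp_homPi : (D₂.aug.comp φ.homPi).ker = D₁.aug.ker := by
  rw [← MonoidHom.comap_ker, ← ModelMLFGaloisData.tmPair_actionKer C₂ D₂, φ.comap_ker,
    ModelMLFGaloisData.tmPair_actionKer C₁ D₁]

/-- `φ_Π` covers a homomorphism of arithmetic quotients: `∃ β, β ∘ ε₁ = ε₂ ∘ φ_Π` (`ε₁` is onto and
`Ker ε₁ = Ker(ε₂ ∘ φ_Π)`). [cite: MochizukiAbsTopIII2015, Definition 3.1 (ii) p.67] -/
theorem exists_galoisMonoidHom :
    ∃ β : (C₁.K ≃ₐ[C₁.k] C₁.K) →* (C₂.K ≃ₐ[C₂.k] C₂.K), ∀ g, β (D₁.aug g) = D₂.aug (φ.homPi g) := by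
  let e₁ := QuotientGroup.quotientKerEquivOfSurjective D₁.aug D₁.aug_surjective
  let q : D₁.Pi ⧸ D₁.aug.ker →* (C₂.K ≃ₐ[C₂.k] C₂.K) :=
    QuotientGroup.lift D₁.aug.ker (D₂.aug.comp φ.homPi) (le_of_eq φ.ker_aug_comp_homPi.symm)
  refine ⟨q.comp e₁.symm.toMonoidHom, fun g => ?_⟩
  have h1 : e₁.symm (D₁.aug g) = QuotientGroup.mk g := by
    rw [MulEquiv.symm_apply_eq]
    rfl
  rw [MonoidHom.comp_apply, MulEquiv.coe_toMonoidHom, h1]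
  rfl

/-- **The homomorphism of arithmetic Galois groups `β : Gal(k̄₁/k₁) → Gal(k̄₂/k₂)` covered by `φ_Π`.**
[cite: MochizukiAbsTopIII2015, Definition 3.1 (ii) p.67] -/
def galoisHom : (C₁.K ≃ₐ[C₁.k] C₁.K) →* (C₂.K ≃ₐ[C₂.k] C₂.K) :=
  Classical.choose φ.exists_galoisMonoidHom

/-- `β ∘ ε₁ = ε₂ ∘ φ_Π`. [cite: MochizukiAbsTopIII2015, Definition 3.1 (ii) p.67] -/
theorem galoisHom_aug (g : D₁.Pi) : φ.galoisHom (D₁.aug g) = D₂.aug (φ.homPi g) :=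
  Classical.choose_spec φ.exists_galoisMonoidHom g

/-- `β` is THE covered homomorphism. [cite: MochizukiAbsTopIII2015, Definition 3.1 (ii) p.67] -/
theorem eq_galoisHom_of_aug (β : (C₁.K ≃ₐ[C₁.k] C₁.K) →* (C₂.K ≃ₐ[C₂.k] C₂.K))
    (hβ : ∀ g, β (D₁.aug g) = D₂.aug (φ.homPi g)) (σ : C₁.K ≃ₐ[C₁.k] C₁.K) : β σ = φ.galoisHom σ := by
  obtain ⟨g, rfl⟩ := D₁.aug_surjective σ
  rw [hβ, galoisHom_aug]

/-- **`β` is injective** («open injective homomorphism»). [cite: MochizukiAbsTopIII2015, Definition 3.1 (ii) p.67] -/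
theorem galoisHom_injective : Function.Injective φ.galoisHom := by
  rw [injective_iff_map_eq_one]
  intro σ hσ
  obtain ⟨g, rfl⟩ := D₁.aug_surjective σ
  rw [galoisHom_aug] at hσ
  have hg : g ∈ (D₂.aug.comp φ.homPi).ker := hσ
  rw [ker_aug_comp_homPi] at hg
  exact hg

/-- **`β` is continuous when `ε₁` is an open map** (print: «the quotient `Π_k ↠ G_k`»): the preimage of an
open set is the `ε₁`-image of an open set. [cite: MochizukiAbsTopIII2015, Definition 3.1 (i) p.67] -/
theorem continuous_galoisHom (h₁ : IsOpenMap D₁.aug) : Continuous φ.galoisHom := by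
  rw [continuous_def]
  intro V hV
  have hpre : φ.galoisHom ⁻¹' V = D₁.aug '' (φ.homPi ⁻¹' (D₂.aug ⁻¹' V)) := by
    ext σ
    constructor
    · intro hσ
      obtain ⟨g, rfl⟩ := D₁.aug_surjective σ
      refine ⟨g, ?_, rfl⟩
      show D₂.aug (φ.homPi g) ∈ V
      rw [← galoisHom_aug]
      exact hσ
    · rintro ⟨g, hg, rfl⟩
      show φ.galoisHom (D₁.aug g) ∈ V
      rw [galoisHom_aug]
      exact hg
  rw [hpre]
  exact h₁ _ ((hV.preimage D₂.continuous_aug).preimage φ.continuous_homPi)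

/-- The image of `β` is the `ε₂`-image of the saturation `φ_Π(Π₁) · Ker ε₂`.
[cite: MochizukiAbsTopIII2015, Definition 3.1 (ii) p.67] -/
theorem range_galoisHom :
    Set.range φ.galoisHom = ((((⊤ : Subgroup D₁.Pi).map φ.homPi ⊔ D₂.aug.ker).map D₂.aug :
      Subgroup (C₂.K ≃ₐ[C₂.k] C₂.K)) : Set (C₂.K ≃ₐ[C₂.k] C₂.K)) := by
  rw [Subgroup.map_sup, (Subgroup.map_eq_bot_iff _).mpr le_rfl, sup_bot_eq, Subgroup.coe_map, Subgroup.coe_map]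
  ext τ
  constructor
  · rintro ⟨σ, rfl⟩
    obtain ⟨g, rfl⟩ := D₁.aug_surjective σ
    exact ⟨φ.homPi g, ⟨g, Subgroup.mem_top g, rfl⟩, (φ.galoisHom_aug g).symm⟩
  · rintro ⟨_, ⟨g, -, rfl⟩, rfl⟩
    exact ⟨D₁.aug g, φ.galoisHom_aug g⟩

/-- **`β` has open image when `ε₂` is an open map** (the saturation `φ_Π(Π₁) · Ker ε₂` is open by
`isOpen_image`). [cite: MochizukiAbsTopIII2015, Definition 3.1 (ii) p.67] -/
theorem isOpen_range_galoisHom (h₂ : IsOpenMap D₂.aug) : IsOpen (Set.range φ.galoisHom) := by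
  rw [range_galoisHom, Subgroup.coe_map]
  have hopen := φ.isOpen_image ⊤ isOpen_univ
  rw [ModelMLFGaloisData.tmPair_actionKer C₂ D₂] at hopen
  exact h₂ _ hopen

/-- **`β` as a CONTINUOUS homomorphism** (for open `ε₁`). [cite: MochizukiAbsTopIII2015, Definition 3.1 (ii) p.67] -/
def galoisContinuousHom (h₁ : IsOpenMap D₁.aug) : (C₁.K ≃ₐ[C₁.k] C₁.K) →ₜ* (C₂.K ≃ₐ[C₂.k] C₂.K) where
  toMonoidHom := φ.galoisHom
  continuous_toFun := φ.continuous_galoisHom h₁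

/-- **`β` on Mathlib's absolute Galois groups** `G_{k₁} →ₜ* G_{k₂}` (for open `ε₁`).
[cite: MochizukiAbsTopIII2015, Definition 3.1 (ii) p.67] -/
def absGaloisHom (h₁ : IsOpenMap D₁.aug) : absoluteGaloisGroup C₁.k →ₜ* absoluteGaloisGroup C₂.k where
  toMonoidHom := ((algEquivContinuousMulEquivAbsoluteGaloisGroup C₂.k C₂.K).toMonoidHom.comp φ.galoisHom).comp
    (algEquivContinuousMulEquivAbsoluteGaloisGroup C₁.k C₁.K).symm.toMonoidHom
  continuous_toFun := (algEquivContinuousMulEquivAbsoluteGaloisGroup C₂.k C₂.K).continuous.comp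
    ((φ.continuous_galoisHom h₁).comp (algEquivContinuousMulEquivAbsoluteGaloisGroup C₁.k C₁.K).symm.continuous)

/-- `β ∘ augGal₁ = augGal₂ ∘ φ_Π`. [cite: MochizukiAbsTopIII2015, Definition 3.1 (ii) p.67] -/
theorem absGaloisHom_augGal (h₁ : IsOpenMap D₁.aug) (g : D₁.Pi) :
    φ.absGaloisHom h₁ (D₁.augGal C₁ g) = D₂.augGal C₂ (φ.homPi g) := by
  show algEquivContinuousMulEquivAbsoluteGaloisGroup C₂.k C₂.K (φ.galoisHom
      ((algEquivContinuousMulEquivAbsoluteGaloisGroup C₁.k C₁.K).symm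
        (algEquivContinuousMulEquivAbsoluteGaloisGroup C₁.k C₁.K (D₁.aug g)))) =
    algEquivContinuousMulEquivAbsoluteGaloisGroup C₂.k C₂.K (D₂.aug (φ.homPi g))
  rw [ContinuousMulEquiv.symm_apply_apply, galoisHom_aug]

/-- `β` on absolute Galois groups is injective. [cite: MochizukiAbsTopIII2015, Definition 3.1 (ii) p.67] -/
theorem absGaloisHom_injective (h₁ : IsOpenMap D₁.aug) : Function.Injective (φ.absGaloisHom h₁) :=
  (algEquivContinuousMulEquivAbsoluteGaloisGroup C₂.k C₂.K).injective.comp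
    (φ.galoisHom_injective.comp (algEquivContinuousMulEquivAbsoluteGaloisGroup C₁.k C₁.K).symm.injective)

/-- `β` on absolute Galois groups has open image (for open `ε₂`). [cite: MochizukiAbsTopIII2015, Definition 3.1 (ii) p.67] -/
theorem isOpen_range_absGaloisHom (h₁ : IsOpenMap D₁.aug) (h₂ : IsOpenMap D₂.aug) :
    IsOpen (Set.range (φ.absGaloisHom h₁)) := by
  have hr : Set.range (φ.absGaloisHom h₁) =
      algEquivContinuousMulEquivAbsoluteGaloisGroup C₂.k C₂.K '' Set.range φ.galoisHom := by
    ext τ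
    constructor
    · rintro ⟨σ, rfl⟩
      exact ⟨φ.galoisHom ((algEquivContinuousMulEquivAbsoluteGaloisGroup C₁.k C₁.K).symm σ), ⟨_, rfl⟩, rfl⟩
    · rintro ⟨_, ⟨σ, rfl⟩, rfl⟩
      refine ⟨algEquivContinuousMulEquivAbsoluteGaloisGroup C₁.k C₁.K σ, ?_⟩
      show algEquivContinuousMulEquivAbsoluteGaloisGroup C₂.k C₂.K (φ.galoisHom
          ((algEquivContinuousMulEquivAbsoluteGaloisGroup C₁.k C₁.K).symm
            (algEquivContinuousMulEquivAbsoluteGaloisGroup C₁.k C₁.K σ))) = _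
      rw [ContinuousMulEquiv.symm_apply_apply]
  rw [hr]
  exact (algEquivContinuousMulEquivAbsoluteGaloisGroup C₂.k C₂.K).isOpenMap _ (φ.isOpen_range_galoisHom h₂)

/-! ### §2 The group-theoretic coefficient identification `μ_Ẑ(β)` and the two legs of the cospan -/

section Coefficients

variable (h₁ : IsOpenMap D₁.aug) (h₂ : IsOpenMap D₂.aug)

/-- **`μ_Ẑ(β) : μ_Ẑ(G_{k₁}) ⥲ μ_Ẑ(G_{k₂})`** — Cor. 1.10 (i)'s functoriality of the group-theoretic cyclotome in
the injective open homomorphism `β` (`muZhat.mapOfOpenEmbedding`: transport to `β(G_{k₁})`, then open-subgroup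
invariance). [cite: MochizukiAbsTopIII2015, Cor 1.10 (i) p.42] -/
def muZhatMap : muZhat (absoluteGaloisGroup C₁.k) ≃* muZhat (absoluteGaloisGroup C₂.k) :=
  muZhat.mapOfOpenEmbedding (φ.absGaloisHom h₁) (φ.absGaloisHom_injective h₁)
    (φ.isOpen_range_absGaloisHom h₁ h₂)

/-- `μ_Ẑ(β)` is equivariant along `φ_Π`: `μ_Ẑ(β)(augGal₁ g • ζ) = augGal₂ (φ_Π g) • μ_Ẑ(β) ζ`.
[cite: MochizukiAbsTopIII2015, Cor 1.10 (i) p.42] -/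
theorem muZhatMap_smul (g : D₁.Pi) (ζ : muZhat (absoluteGaloisGroup C₁.k)) :
    φ.muZhatMap h₁ h₂ (D₁.augGal C₁ g • ζ) = D₂.augGal C₂ (φ.homPi g) • φ.muZhatMap h₁ h₂ ζ := by
  rw [muZhatMap, muZhat.mapOfOpenEmbedding_smul, absGaloisHom_augGal]

variable (R₁ : TorsionReciprocityData C₁.k) (R₂ : TorsionReciprocityData C₂.k)
  {H₁ : OpenSubgroup D₁.tmPair.Pi} {H₂ : OpenSubgroup D₂.tmPair.Pi}
  (hH : (H₁ : Subgroup D₁.Pi).map φ.homPi ≤ (H₂ : Subgroup D₂.Pi))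

/-- **The coefficient morphism `μ_Ẑ(β) : μ_Ẑ(G_{k₁})|_{H₁} ⟶ res_{φ_Π} μ_Ẑ(G_{k₂})|_{H₂}`** of `ℤ`-linear
`H₁`-representations. [cite: MochizukiAbsTopIII2015, Proposition 3.2 (ii) p.72] -/
def muZhatCoeffHom :
    ModelMLFGaloisData.muZhatRep C₁ D₁ R₁ (H₁ : Subgroup D₁.Pi) ⟶
      Rep.res (φ.unitsMorphism.groupHomRestrict hH) (ModelMLFGaloisData.muZhatRep C₂ D₂ R₂ (H₂ : Subgroup D₂.Pi)) :=
  Rep.ofHom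
    { toLinearMap := (MonoidHom.toAdditive
          (φ.muZhatMap h₁ h₂ : muZhat (absoluteGaloisGroup C₁.k) →* muZhat (absoluteGaloisGroup C₂.k))).toIntLinearMap
      isIntertwining' := fun γ => LinearMap.ext fun v => by
        change Additive.ofMul (φ.muZhatMap h₁ h₂
            (D₁.augGal C₁ (γ : D₁.Pi) • (Additive.toMul v : muZhat (absoluteGaloisGroup C₁.k)))) =
          Additive.ofMul (D₂.augGal C₂ (φ.homPi (γ : D₁.Pi)) •
            φ.muZhatMap h₁ h₂ (Additive.toMul v : muZhat (absoluteGaloisGroup C₁.k)))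
        rw [muZhatMap_smul] }

/-- **Pull-back leg `φ_Π^* : H¹(H₂, μ_Ẑ(G_{k₂})) → H¹(H₁, res_{φ_Π} μ_Ẑ(G_{k₂}))`.**
[cite: MochizukiAbsTopIII2015, Proposition 3.2 (ii) p.72] -/
abbrev pullMuZhat :
    groupCohomology.H1 (ModelMLFGaloisData.muZhatRep C₂ D₂ R₂ (H₂ : Subgroup D₂.Pi)) ⟶
      groupCohomology.H1 (Rep.res (φ.unitsMorphism.groupHomRestrict hH)
        (ModelMLFGaloisData.muZhatRep C₂ D₂ R₂ (H₂ : Subgroup D₂.Pi))) :=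
  groupCohomology.map (φ.unitsMorphism.groupHomRestrict hH) (𝟙 _) 1

/-- **Push-forward leg `μ_Ẑ(β)_* : H¹(H₁, μ_Ẑ(G_{k₁})) → H¹(H₁, res_{φ_Π} μ_Ẑ(G_{k₂}))`.**
[cite: MochizukiAbsTopIII2015, Proposition 3.2 (ii) p.72] -/
abbrev pushMuZhat :
    groupCohomology.H1 (ModelMLFGaloisData.muZhatRep C₁ D₁ R₁ (H₁ : Subgroup D₁.Pi)) ⟶
      groupCohomology.H1 (Rep.res (φ.unitsMorphism.groupHomRestrict hH)
        (ModelMLFGaloisData.muZhatRep C₂ D₂ R₂ (H₂ : Subgroup D₂.Pi))) :=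
  groupCohomology.map (MonoidHom.id _) (φ.muZhatCoeffHom h₁ h₂ R₁ R₂ hH) 1

/-! ### §3 Naturality of the `μ_Ẑ(G)`-valued Kummer maps along `φ`, given the coefficient square -/

/-- `res_{φ_Π} μ_Ẑ(G_{k₂})|_{H₂}`: the coefficients of the target of the cospan, an `H₁`-representation.
[cite: MochizukiAbsTopIII2015, Proposition 3.2 (ii) p.72] -/
abbrev resMuZhatRep : Rep ℤ (H₁ : Subgroup D₁.Pi) :=
  Rep.res (φ.unitsMorphism.groupHomRestrict hH) (ModelMLFGaloisData.muZhatRep C₂ D₂ R₂ (H₂ : Subgroup D₂.Pi))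

/-- `res_{φ_Π}` of Rmk. 3.2.1 at the second model: `res μ_Ẑ(G_{k₂})|_{H₂} ⟶ res Λ(k̄₂ˣ)|_{H₂}`
(`Λ(rootsHom₂)`). [cite: MochizukiAbsTopIII2015, Remark 3.2.1 p.73] -/
abbrev resCoeffHom : φ.resMuZhatRep R₂ hH ⟶ φ.unitsMorphism.resRep hH :=
  (Rep.resFunctor (φ.unitsMorphism.groupHomRestrict hH)).map (ModelMLFGaloisData.coeffHom C₂ D₂ R₂ (H₂ : Subgroup D₂.Pi))

/-- `H¹(H₁, res_{φ_Π} Rmk. 3.2.1) : H¹(H₁, res μ_Ẑ(G_{k₂})) → H¹(H₁, res Λ(k̄₂ˣ))`.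
[cite: MochizukiAbsTopIII2015, Remark 3.2.1 p.73] -/
abbrev mapResCoeff : groupCohomology.H1 (φ.resMuZhatRep R₂ hH) ⟶ groupCohomology.H1 (φ.unitsMorphism.resRep hH) :=
  groupCohomology.map (A := φ.resMuZhatRep R₂ hH) (B := φ.unitsMorphism.resRep hH) (MonoidHom.id _)
    (φ.resCoeffHom R₂ hH) 1

/-- `H¹(H₁, res Rmk. 3.2.1)` is injective (its coefficient map `Λ(rootsHom₂)` is bijective).
[cite: MochizukiAbsTopIII2015, Remark 3.2.1 p.73] -/
theorem mapResCoeff_injective : Function.Injective (φ.mapResCoeff R₂ hH) := by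
  let e' : (φ.resMuZhatRep R₂ hH).V ≃ₗ[ℤ] (φ.unitsMorphism.resRep hH).V :=
    LinearEquiv.ofBijective (φ.resCoeffHom R₂ hH).hom.toLinearMap (ModelMLFGaloisData.map_rootsHom_bijective C₂ R₂)
  let I := groupCohomology.mapIso (A := φ.unitsMorphism.resRep hH) (B := φ.resMuZhatRep R₂ hH) (MulEquiv.refl _) e'
    (fun g => by
      ext v
      exact (ModelMLFGaloisData.cycCoMorphism C₂ D₂ R₂).cyclotome_map_smul (φ.homPi (g : D₁.Pi))
        (Additive.toMul v)) 1
  have hI : I.hom = φ.mapResCoeff R₂ hH := by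
    change groupCohomology.map _ _ 1 = groupCohomology.map _ _ 1
    refine groupCohomology.map_congr ?_ ?_ 1
    · exact MonoidHom.ext fun _ => rfl
    · exact LinearMap.ext fun _ => rfl
  rw [← hI]
  exact (ConcreteCategory.bijective_of_isIso I.hom).1

/-- **[AbsTopIII] Prop 3.2 (ii) with `μ_Ẑ(G)`-coefficients: NATURALITY along a MORPHISM of model
`TM`-pairs, given the coefficient square.**  Let `φ = (φ_Π, φ_M)` be a morphism of model MLF-Galois
`TM`-pairs with open augmentations, `H₁ ⊆ Π₁`, `H₂ ⊆ Π₂` open with `φ_Π(H₁) ⊆ H₂`, data `R₁`, `R₂` whose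
Rmk. 3.2.1 identifications intertwine the group-theoretic `μ_Ẑ(β)` with `Λ(φ_M^gp)` (`hsq`), and
`m ∈ (𝒪_k̄₁^⊳)^{H₁}` with `φ_M(m) ∈ (𝒪_k̄₂^⊳)^{H₂}`.  Then
`φ_Π^* (κ^G_{H₂}(φ_M m)) = μ_Ẑ(β)_* (κ^G_{H₁}(m))` in `H¹(H₁, res_{φ_Π} μ_Ẑ(G_{k₂}))` — the `μ_Ẑ(G)`-twin of
abc-iut-L4-t2's `ModelMLFGaloisData.kummer_natural` (from which it follows through `H¹(Rmk. 3.2.1)`).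
[cite: MochizukiAbsTopIII2015, Proposition 3.2 (ii) p.72] -/
theorem pullMuZhat_kummerMuZhat_eq_pushMuZhat_of_square
    (hsq : ∀ ζ : muZhat (absoluteGaloisGroup C₁.k),
      EtaleTheta.cyclotome.map (ModelMLFGaloisData.rootsHom C₂ R₂) (φ.muZhatMap h₁ h₂ ζ) =
        EtaleTheta.cyclotome.map (ModelMLFGaloisData.unitsLift φ.homM)
          (EtaleTheta.cyclotome.map (ModelMLFGaloisData.rootsHom C₁ R₁) ζ))
    (m : {m : D₁.tmPair.M // ∀ h : H₁, (h : D₁.tmPair.Pi) • m = m})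
    (hm : ∀ h : H₂, (h : D₂.tmPair.Pi) • φ.homM m.1 = φ.homM m.1) :
    φ.pullMuZhat R₂ hH (ModelMLFGaloisData.kummerMuZhat C₂ D₂ R₂ H₂ ⟨φ.homM m.1, hm⟩) =
      φ.pushMuZhat h₁ h₂ R₁ R₂ hH (ModelMLFGaloisData.kummerMuZhat C₁ D₁ R₁ H₁ m) := by
  apply φ.mapResCoeff_injective R₂ hH
  -- the `Λ(k̄ˣ)`-valued naturality of the model Kummer maps (p429531)
  have hnat := ModelMLFGaloisData.kummer_natural φ.homPi φ.homM φ.smul_comm H₁ H₂ hH m hm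
  -- left leg: `T (φ_Π^* x) = φ_Π^* (coeffIso₂ x)`
  have hL : φ.pullMuZhat R₂ hH ≫ φ.mapResCoeff R₂ hH =
      (ModelMLFGaloisData.coeffIso C₂ D₂ R₂ (H₂ : Subgroup D₂.Pi)).hom ≫ φ.unitsMorphism.pullH1 hH := by
    rw [ModelMLFGaloisData.coeffIso_hom, EquivariantMorphism.pullH1, pullMuZhat, mapResCoeff,
      ← groupCohomology.map_comp, ← groupCohomology.map_comp]
    exact groupCohomology.map_congr rfl (LinearMap.ext fun _ => rfl) 1
  -- right leg: `T (μ_Ẑ(β)_* y) = Λ(φ_M^gp)_* (coeffIso₁ y)` — the coefficient square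
  have hR : φ.pushMuZhat h₁ h₂ R₁ R₂ hH ≫ φ.mapResCoeff R₂ hH =
      (ModelMLFGaloisData.coeffIso C₁ D₁ R₁ (H₁ : Subgroup D₁.Pi)).hom ≫ φ.unitsMorphism.pushH1 hH := by
    rw [ModelMLFGaloisData.coeffIso_hom, EquivariantMorphism.pushH1, pushMuZhat, mapResCoeff,
      ← groupCohomology.map_id_comp, ← groupCohomology.map_id_comp]
    refine groupCohomology.map_congr rfl (LinearMap.ext fun v => ?_) 1
    change Additive.ofMul (EtaleTheta.cyclotome.map (ModelMLFGaloisData.rootsHom C₂ R₂)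
          (φ.muZhatMap h₁ h₂ (Additive.toMul v))) =
      Additive.ofMul (EtaleTheta.cyclotome.map (ModelMLFGaloisData.unitsLift φ.homM)
        (EtaleTheta.cyclotome.map (ModelMLFGaloisData.rootsHom C₁ R₁) (Additive.toMul v)))
    rw [hsq]
    rfl
  have hL' := congrArg (fun ψ : groupCohomology.H1 (ModelMLFGaloisData.muZhatRep C₂ D₂ R₂ (H₂ : Subgroup D₂.Pi)) ⟶
      groupCohomology.H1 (φ.unitsMorphism.resRep hH) =>
    ψ (ModelMLFGaloisData.kummerMuZhat C₂ D₂ R₂ H₂ ⟨φ.homM m.1, hm⟩)) hL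
  have hR' := congrArg (fun ψ : groupCohomology.H1 (ModelMLFGaloisData.muZhatRep C₁ D₁ R₁ (H₁ : Subgroup D₁.Pi)) ⟶
      groupCohomology.H1 (φ.unitsMorphism.resRep hH) =>
    ψ (ModelMLFGaloisData.kummerMuZhat C₁ D₁ R₁ H₁ m)) hR
  simp only [ModuleCat.hom_comp, LinearMap.coe_comp, Function.comp_apply] at hL' hR'
  change φ.mapResCoeff R₂ hH (φ.pullMuZhat R₂ hH _) = _ at hL'
  change φ.mapResCoeff R₂ hH (φ.pushMuZhat h₁ h₂ R₁ R₂ hH _) = _ at hR'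
  rw [hL', hR', ModelMLFGaloisData.coeffIso_hom_kummerMuZhat, ModelMLFGaloisData.coeffIso_hom_kummerMuZhat]
  exact hnat

end Coefficients

end GaloisMonoidPair.Hom

/-! ### §4 The square FAILS along the power endomorphisms: functorial on `𝒞̲`, not on `𝒞` -/

namespace ModelMLFGaloisData

variable (C : MLFClosure.{0}) (D : ModelMLFGaloisData C.k C.K) (R : TorsionReciprocityData C.k)

/-- The element `2 ∈ 𝒪_k̄^⊳`. [cite: MochizukiAbsTopIII2015, Definition 3.1 (i) p.66] -/
def two : nonzeroIntegers C.k C.K :=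
  GaloisMonoidPair.Iso.ofInteger C (Units.mk0 (2 : C.k) two_ne_zero)
    (by
      rw [Units.val_mk0, ← one_add_one_eq_two]
      exact (Valuation.map_add _ _ _).trans (by rw [Valuation.map_one, max_self]))

/-- `2` is fixed by every subgroup (it lies in `k`). [cite: MochizukiAbsTopIII2015, Definition 3.1 (i) p.66] -/
theorem smul_two (g : D.Pi) : g • two C = two C := by
  apply Subtype.ext
  change D.aug g • (algebraMap C.k C.K (2 : C.k)) = algebraMap C.k C.K (2 : C.k)
  rw [AlgEquiv.smul_def, AlgEquiv.commutes]

/-- **The `μ_Ẑ(G)`-valued Kummer map is NOT natural along the power endomorphism `(𝟙_Π, x ↦ x²)` with the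
group-theoretic (= identity, `β = 𝟙`) identification of targets**: `κ^G_H(m²) = 2 κ^G_H(m) ≠ κ^G_H(m)` for
`m = 2` (Kummer-faithfulness; `ε_k` open).  Since `(𝟙_Π, x ↦ x²)` IS a morphism of MLF-Galois `TM`-pairs
(abc-iut-L4-t9's `GaloisMonoidPair.powEnd`, finding E-L4-10), «`μ_Ẑ(M_TM)` may be replaced by `μ_Ẑ(G)`» is
functorial on isomorphisms and `T`-isomorphisms (`𝒞̲`), not along all of `𝒞^MLF_TM`.
[cite: MochizukiAbsTopIII2015, Proposition 3.2 (ii) p.72] -/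
theorem kummerMuZhat_powEnd_ne (hε : IsOpenMap D.aug) (H : OpenSubgroup D.tmPair.Pi) :
    kummerMuZhat C D R H ⟨(GaloisMonoidPair.powEnd D.tmPair 2).homM (two C), fun h => by
        rw [GaloisMonoidPair.powEnd_homM_apply, smul_pow', smul_two]⟩ ≠
      kummerMuZhat C D R H ⟨two C, fun h => smul_two C D h⟩ := by
  intro h
  have hmul := kummerMuZhat_mul C D R H ⟨two C, fun h => smul_two C D h⟩ ⟨two C, fun h => smul_two C D h⟩
  have hsq : (⟨(GaloisMonoidPair.powEnd D.tmPair 2).homM (two C), fun h => by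
        rw [GaloisMonoidPair.powEnd_homM_apply, smul_pow', smul_two]⟩ :
        {m : D.tmPair.M // ∀ h : H, (h : D.tmPair.Pi) • m = m}) =
      ⟨(two C) * (two C), fun h => by rw [smul_mul', smul_two]⟩ := Subtype.ext (pow_two _)
  rw [hsq, hmul, add_eq_right] at h
  -- `κ^G_H(2) = 0 = κ^G_H(1)` forces `2 = 1`
  have h1 : kummerMuZhat C D R H ⟨1, fun h => smul_one _⟩ = 0 := by
    have := kummerMuZhat_mul C D R H ⟨1, fun h => smul_one _⟩ ⟨1, fun h => smul_one _⟩
    have e : (⟨(1 : D.tmPair.M) * 1, fun h => by rw [smul_mul', smul_one]⟩ :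
        {m : D.tmPair.M // ∀ h : H, (h : D.tmPair.Pi) • m = m}) = ⟨1, fun h => smul_one _⟩ :=
      Subtype.ext (mul_one _)
    rw [e, left_eq_add] at this
    exact this
  rw [← h1] at h
  have h2 := congrArg Subtype.val (kummerMuZhat_injective C D R hε H h)
  have h3 : (algebraMap C.k C.K (2 : C.k)) = 1 := congrArg Subtype.val h2
  rw [map_ofNat] at h3
  exact one_ne_zero (calc (1 : C.K) = 2 - 1 := by norm_num
    _ = 1 - 1 := by rw [h3]
    _ = 0 := sub_self 1)

end ModelMLFGaloisData

end Literature.AnabelianGeometry.AbsoluteAnabelian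

end
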